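import Summits.PneNP.PneNP.Theorems.KarlinRubinMonotoneBlindFormErr
import Summits.PneNP.PneNP.Theorems.KarlinRubinMonotoneBlindDepth3Blind

/-!
# Route KarlinRubin, crux `MonotoneBlind` (stmt-PneNP-18027): MONOTONE AC⁰ IS BLIND (every constant depth)

**Theorem (`karlinRubin_monotoneBlind_constDepth`).** For `0 < δ < 1/2` and all constants `c, d`: no family of
monotone formulas `f_n` of depth `d + 1` on the edge slots of `Kₙ` — alternating layers of unbounded fan-in AND/OR gates
of fan-in `≤ n^c` above single slots (the layered forms `swForm n (d+1)` of `…FormDefs` with `swBnd (n^c) 1`; every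
monotone circuit of constant depth and polynomial size unfolds into one, constant `0/1` leaves being empty gates) — has
`Pr_{G(n,1/2)}[f_n] + Pr_{G(n,1/2,⌈n^{1/2-δ}⌉)}[¬ f_n] → 0`. Equivalently (`karlinRubin_constDepth_planted_tendsto_zero`)
quiet families (null acceptance `→ 0`) have planted acceptance `→ 0`: polynomial-size monotone AC⁰ is BLIND to planted
cliques of size `n^{1/2-δ}`, at every constant depth. Depth 2 and the two depth-3 classes are `…DnfBlind`, `…CnfBlind`,
`…Depth3Blind`, `…Pi3Blind`; this file closes stage C of the seat write-up `MonotoneBlind_AC0_announce.md`.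

Proof: the depth reduction `swForm_planted_le` / `swErr_le_uniform` along the universe sizes
`m_i = ⌈n^{1 - iη}⌉`, `η = δ/(d+1)`, with vertex cutoff `v₀ = ⌊(E+1)/η⌋ + 1`, `E = cd + c + 2`: every one of the `d`
switching steps costs `≤ 1/n` (`swT_budget`, `swSize_ratio`) and the final narrow CNF costs `≤ 1/n`
(`eventually_swSize_last`), so `Pr_{planted}[f_n] ≤ Pr_{null}[f_n] + (d+1)/n`.

All `--supports stmt-PneNP-18027`; no definitions.
-/

set_option linter.dupNamespace false -- `Summit.PneNP.PneNP.…`: summit = sub-problem (D-0017)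

namespace Summit.PneNP.PneNP.Theorems

open Finset Filter Topology
open scoped ENNReal
open Literature.Computability.Complexity
open Literature.Probability.RandomGraphs.PlantedClique

variable {n : ℕ}

/-! ### The sizes are admissible -/

/-- Admissibility of `swSizes` from pointwise facts. [folklore] -/
theorem swSizeOK_swSizes (n : ℕ) (η : ℝ) (v₀ k : ℕ) (hk2 : 2 ≤ k) :
    ∀ (d i : ℕ), (∀ j, j < i + d → swSize n η (j + 1) ≤ swSize n η j) → (∀ j, j ≤ i + d → v₀ ≤ swSize n η j) →
      k ≤ swSize n η (i + d) → swSizeOK v₀ k (swSize n η i) (swSizes n η i d) := by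
  intro d
  induction d with
  | zero => intro i _ _ hk; exact ⟨hk2, hk⟩
  | succ d ih =>
    intro i hanti hv hk
    refine ⟨hv (i + 1) (by omega), hanti i (by omega),
      ih (i + 1) (fun j hj => hanti j (by omega)) (fun j hj => hv j (by omega)) ?_⟩
    rwa [show i + 1 + d = i + (d + 1) by omega]

/-- The shrinking condition for `swSizes` from pointwise facts. [folklore] -/
theorem swRatioOK_swSizes (n : ℕ) (η : ℝ) (v₀ E N₀ : ℕ) :
    ∀ (d i : ℕ), (∀ j, j < i + d → swSize n η (j + 1) ^ v₀ * N₀ ^ E ≤ swSize n η j ^ v₀) →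
      swRatioOK v₀ E N₀ (swSize n η i) (swSizes n η i d) := by
  intro d
  induction d with
  | zero => intro i _; trivial
  | succ d ih => intro i h; exact ⟨h i (by omega), ih (i + 1) fun j hj => h j (by omega)⟩

/-! ### Pointwise and eventual facts about the sizes -/

/-- The sizes decrease (for `n ≥ 1`, `η ≥ 0`). [folklore] -/
theorem swSize_anti {η : ℝ} (hη : 0 ≤ η) (hn : 1 ≤ n) (j : ℕ) : swSize n η (j + 1) ≤ swSize n η j := by
  have hn1R : (1 : ℝ) ≤ n := by exact_mod_cast hn
  refine Nat.ceil_mono (Real.rpow_le_rpow_of_exponent_le hn1R ?_)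
  push_cast
  nlinarith

/-- The sizes are antitone (for `n ≥ 1`, `η ≥ 0`). [folklore] -/
theorem swSize_le_swSize {η : ℝ} (hη : 0 ≤ η) (hn : 1 ≤ n) (j : ℕ) : ∀ t : ℕ, swSize n η (j + t) ≤ swSize n η j := by
  intro t
  induction t with
  | zero => exact le_rfl
  | succ t ih => exact (swSize_anti hη hn (j + t)).trans ih

/-- **One switching step gains `n^E`**: `⌈n^{1-(j+1)η}⌉^{v₀} n^E ≤ ⌈n^{1-jη}⌉^{v₀}` once `η v₀ ≥ E + 1`,
`(j+1) η ≤ 1` and `n ≥ 2^{v₀}`. [folklore] -/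
theorem swSize_ratio {η : ℝ} {E v₀ : ℕ} (hgap : (E : ℝ) + 1 ≤ η * v₀) (hn : 2 ^ v₀ ≤ n) (j : ℕ)
    (hj : ((j : ℝ) + 1) * η ≤ 1) : swSize n η (j + 1) ^ v₀ * n ^ E ≤ swSize n η j ^ v₀ := by
  have hn1 : 1 ≤ n := le_trans (Nat.one_le_two_pow) hn
  have hnR : (0 : ℝ) < n := by exact_mod_cast hn1
  have hn1R : (1 : ℝ) ≤ n := by exact_mod_cast hn1
  set a : ℝ := 1 - ((j : ℝ) + 1) * η with ha
  set b : ℝ := 1 - (j : ℝ) * η with hb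
  have ha0 : 0 ≤ a := by rw [ha]; linarith
  have hna1 : (1 : ℝ) ≤ (n : ℝ) ^ a := Real.one_le_rpow hn1R ha0
  have hceil : (⌈(n : ℝ) ^ a⌉₊ : ℝ) ≤ 2 * (n : ℝ) ^ a := by
    have := Nat.ceil_lt_add_one (zero_le_one.trans hna1); linarith
  have h2v : (2 : ℝ) ^ v₀ ≤ (n : ℝ) ^ (η * v₀ - E) := by
    calc (2 : ℝ) ^ v₀ = ((2 ^ v₀ : ℕ) : ℝ) := by push_cast; ring
      _ ≤ n := by exact_mod_cast hn
      _ = (n : ℝ) ^ (1 : ℝ) := (Real.rpow_one _).symm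
      _ ≤ (n : ℝ) ^ (η * v₀ - E) := Real.rpow_le_rpow_of_exponent_le hn1R (by linarith)
  have hreal : (((swSize n η (j + 1) ^ v₀ * n ^ E : ℕ)) : ℝ) ≤ ((swSize n η j ^ v₀ : ℕ) : ℝ) := by
    unfold swSize
    push_cast
    rw [← ha, ← hb]
    calc (⌈(n : ℝ) ^ a⌉₊ : ℝ) ^ v₀ * (n : ℝ) ^ E ≤ (2 * (n : ℝ) ^ a) ^ v₀ * (n : ℝ) ^ E := by gcongr
      _ = 2 ^ v₀ * (n : ℝ) ^ (a * v₀ + E) := by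
          rw [mul_pow, Real.rpow_add hnR, Real.rpow_mul hnR.le, Real.rpow_natCast, Real.rpow_natCast]; ring
      _ ≤ (n : ℝ) ^ (η * v₀ - E) * (n : ℝ) ^ (a * v₀ + E) := by gcongr
      _ = ((n : ℝ) ^ b) ^ v₀ := by
          rw [← Real.rpow_add hnR, ← Real.rpow_natCast, ← Real.rpow_mul hnR.le]
          congr 1; rw [ha, hb]; ring
      _ ≤ (⌈(n : ℝ) ^ b⌉₊ : ℝ) ^ v₀ := by gcongr; exact Nat.le_ceil _
  exact_mod_cast hreal

/-- **The budget of one switching step**: with `M̄ = n^c 2^{rd}` and `T(M̄, L̄) = K₁ + M̄ K₂`,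
`M̄^d (K₁ + M̄ K₂) n ≤ n^{cd+c+2}` once `n ≥ 2^{rd·d}(K₁ + 2^{rd} K₂)`. [folklore] -/
theorem swT_budget (c d r K₁ K₂ n : ℕ) (hn : (2 ^ (r * d)) ^ d * (K₁ + 2 ^ (r * d) * K₂) ≤ n) (hn1 : 1 ≤ n) :
    (n ^ c * 2 ^ (r * d)) ^ d * (K₁ + n ^ c * 2 ^ (r * d) * K₂) * n ≤ n ^ (c * d + c + 2) := by
  have hnc : 0 < n ^ c := Nat.pow_pos hn1
  calc (n ^ c * 2 ^ (r * d)) ^ d * (K₁ + n ^ c * 2 ^ (r * d) * K₂) * n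
      ≤ (n ^ c * 2 ^ (r * d)) ^ d * ((K₁ + 2 ^ (r * d) * K₂) * n ^ c) * n := by
        gcongr
        calc K₁ + n ^ c * 2 ^ (r * d) * K₂ ≤ K₁ * n ^ c + n ^ c * 2 ^ (r * d) * K₂ :=
              Nat.add_le_add_right (Nat.le_mul_of_pos_right _ hnc) _
          _ = (K₁ + 2 ^ (r * d) * K₂) * n ^ c := by ring
    _ = (2 ^ (r * d)) ^ d * (K₁ + 2 ^ (r * d) * K₂) * n ^ (c * d + c + 1) := by ring
    _ ≤ n * n ^ (c * d + c + 1) := Nat.mul_le_mul_right _ hn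
    _ = n ^ (c * d + c + 2) := by ring

/-- **The last term is `≤ 1/n` eventually**: `L̄ k² n ≤ ⌈n^{1-dη}⌉²` for `k = ⌈n^{1/2-δ}⌉`, `d η < δ`. [folklore] -/
theorem eventually_swSize_last {δ η : ℝ} (hδ' : δ < 1 / 2) {d : ℕ} (hdη : (d : ℝ) * η < δ) (Lb : ℕ) :
    ∀ᶠ n : ℕ in atTop, Lb * ⌈(n : ℝ) ^ (1 / 2 - δ)⌉₊ ^ 2 * n ≤ swSize n η d ^ 2 := by
  have hgap : (2 - 2 * δ : ℝ) < 2 - 2 * (d * η) := by linarith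
  have hev := eventually_const_mul_log_pow_mul_rpow_le ((4 : ℝ) * Lb) 0 hgap
  filter_upwards [hev, eventually_ge_atTop 1] with n h hn1
  have hnR : (0 : ℝ) < n := by exact_mod_cast hn1
  have hk := ceil_rpow_le_two_mul hδ' hn1
  have hreal : ((Lb * ⌈(n : ℝ) ^ (1 / 2 - δ)⌉₊ ^ 2 * n : ℕ) : ℝ) ≤ ((swSize n η d ^ 2 : ℕ) : ℝ) := by
    unfold swSize
    push_cast
    have hsq : ((n : ℝ) ^ (1 / 2 - δ)) ^ 2 * n = (n : ℝ) ^ (2 - 2 * δ : ℝ) := by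
      rw [← Real.rpow_natCast, ← Real.rpow_mul hnR.le, ← Real.rpow_add_one hnR.ne']
      congr 1; push_cast; ring
    have hsq' : ((n : ℝ) ^ (1 - (d : ℝ) * η)) ^ 2 = (n : ℝ) ^ (2 - 2 * (d * η) : ℝ) := by
      rw [← Real.rpow_natCast, ← Real.rpow_mul hnR.le]
      congr 1; push_cast; ring
    calc (Lb : ℝ) * (⌈(n : ℝ) ^ (1 / 2 - δ)⌉₊ : ℝ) ^ 2 * n
        ≤ (Lb : ℝ) * (2 * (n : ℝ) ^ (1 / 2 - δ)) ^ 2 * n := by gcongr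
      _ = 4 * Lb * Real.log n ^ 0 * (n : ℝ) ^ (2 - 2 * δ : ℝ) := by rw [pow_zero, mul_pow, ← hsq]; ring
      _ ≤ (n : ℝ) ^ (2 - 2 * (d * η) : ℝ) := h
      _ = ((n : ℝ) ^ (1 - (d : ℝ) * η)) ^ 2 := hsq'.symm
      _ ≤ (⌈(n : ℝ) ^ (1 - (d : ℝ) * η)⌉₊ : ℝ) ^ 2 := by gcongr; exact Nat.le_ceil _
  exact_mod_cast hreal

/-- The clique size and the last size are eventually ordered as needed. [folklore] -/
theorem eventually_swSize_params {δ η : ℝ} (hδ : 0 < δ) (hδ' : δ < 1 / 2) {d : ℕ}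
    (hdη : (d : ℝ) * η < 1 / 2) (v₀ : ℕ) :
    ∀ᶠ n : ℕ in atTop, 2 ≤ ⌈(n : ℝ) ^ (1 / 2 - δ)⌉₊ ∧ ⌈(n : ℝ) ^ (1 / 2 - δ)⌉₊ ≤ swSize n η d ∧
      v₀ ≤ swSize n η d := by
  have hexp : (0 : ℝ) < 1 / 2 - δ := by linarith
  have hk2 : ∀ᶠ n : ℕ in atTop, (2 : ℝ) ≤ (n : ℝ) ^ (1 / 2 - δ) :=
    ((tendsto_rpow_atTop hexp).comp tendsto_natCast_atTop_atTop).eventually_ge_atTop 2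
  have hv : ∀ᶠ n : ℕ in atTop, (v₀ : ℝ) ≤ (n : ℝ) ^ (1 - (d : ℝ) * η) :=
    ((tendsto_rpow_atTop (by linarith : (0 : ℝ) < 1 - (d : ℝ) * η)).comp
      tendsto_natCast_atTop_atTop).eventually_ge_atTop _
  filter_upwards [hk2, hv, eventually_ge_atTop 1] with n h2 hv hn1
  have hn1R : (1 : ℝ) ≤ n := by exact_mod_cast hn1
  refine ⟨?_, ?_, ?_⟩
  · have : ((2 : ℕ) : ℝ) ≤ ⌈(n : ℝ) ^ (1 / 2 - δ)⌉₊ := by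
      push_cast; exact h2.trans (Nat.le_ceil _)
    exact_mod_cast this
  · exact Nat.ceil_mono (Real.rpow_le_rpow_of_exponent_le hn1R (by linarith))
  · have : ((v₀ : ℕ) : ℝ) ≤ ⌈(n : ℝ) ^ (1 - (d : ℝ) * η)⌉₊ := hv.trans (Nat.le_ceil _)
    exact_mod_cast this

/-! ### The theorem -/

/-- **Weak blindness of polynomial-size monotone formulas of constant depth (no quietness assumed)**: for
`0 < δ < 1/2`, `c d : ℕ` and level-`(d+1)` layered monotone formulas `f_n` (top gate AND) with fan-ins `≤ n^c` above
single slots, eventually `Pr_{G(n,1/2,⌈n^{1/2-δ}⌉)}[f_n] ≤ Pr_{G(n,1/2)}[f_n] + (d+1)/n`. [folklore] -/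
theorem karlinRubin_constDepth_planted_le_null_add {δ : ℝ} (hδ : 0 < δ) (hδ' : δ < 1 / 2) (c d : ℕ)
    (f : (n : ℕ) → swForm n (d + 1)) (hf : ∀ᶠ n : ℕ in atTop, swBnd (n ^ c) 1 (d + 1) (f n)) :
    ∀ᶠ n : ℕ in atTop, (plantedCliqueDist n ⌈(n : ℝ) ^ (1 / 2 - δ)⌉₊).toOuterMeasure {x | swEval (d + 1) false (f n) x} ≤
      (erdosRenyiHalf n).toOuterMeasure {x | swEval (d + 1) false (f n) x} + ((d + 1 : ℕ) : ℝ≥0∞) * ((n : ℝ≥0∞))⁻¹ := by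
  -- parameters
  set η : ℝ := δ / ((d : ℝ) + 1) with hη
  set E : ℕ := c * d + c + 2 with hE
  set v₀ : ℕ := ⌊((E : ℝ) + 1) / η⌋₊ + 1 with hv₀
  set r : ℕ := (v₀ - 1).choose 2 with hr
  set K₁ : ℕ := 2 ^ (r + r) * (2 * (r + 1 + 1) ^ (2 * r)) ^ (r + 1) with hK₁
  set K₂ : ℕ := (2 * (r + 1)).choose v₀ with hK₂
  have hd1 : (0 : ℝ) < (d : ℝ) + 1 := by positivity
  have hηpos : 0 < η := div_pos hδ hd1
  have hdη : (d : ℝ) * η < δ := by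
    rw [hη, mul_div_assoc', div_lt_iff₀ hd1]; nlinarith
  have hdη' : (d : ℝ) * η < 1 / 2 := hdη.trans hδ'
  have hgap : (E : ℝ) + 1 ≤ η * v₀ := by
    have hlt : ((E : ℝ) + 1) / η < v₀ := by rw [hv₀]; push_cast; exact Nat.lt_floor_add_one _
    rw [div_lt_iff₀ hηpos] at hlt
    linarith
  have hv₀pos : 0 < v₀ := Nat.succ_pos _
  filter_upwards [hf, eventually_swSize_last hδ' hdη (r + 1), eventually_swSize_params hδ hδ' hdη' v₀,
    eventually_ge_atTop (2 ^ v₀), eventually_ge_atTop ((2 ^ (r * d)) ^ d * (K₁ + 2 ^ (r * d) * K₂))]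
    with n hfn hlast hpar h2v hK
  obtain ⟨hk2, hkd, hv₀d⟩ := hpar
  have hn1 : 1 ≤ n := le_trans Nat.one_le_two_pow h2v
  have hnpos : 0 < n := hn1
  -- admissibility and shrinking of the sizes
  have hanti : ∀ j, swSize n η (j + 1) ≤ swSize n η j := fun j => swSize_anti hηpos.le hn1 j
  have hmono : ∀ j, j ≤ d → swSize n η d ≤ swSize n η j := by
    intro j hj
    have h := swSize_le_swSize hηpos.le hn1 j (d - j)
    rwa [Nat.add_sub_cancel' hj] at h
  have hsz : swSizeOK v₀ ⌈(n : ℝ) ^ (1 / 2 - δ)⌉₊ n (swSizes n η 0 d) := by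
    have h := swSizeOK_swSizes n η v₀ ⌈(n : ℝ) ^ (1 / 2 - δ)⌉₊ hk2 d 0 (fun j _ => hanti j)
      (fun j hj => hv₀d.trans (hmono j (by omega))) (by simpa using hkd)
    rwa [swSize_zero] at h
  have hrat : swRatioOK v₀ E n n (swSizes n η 0 d) := by
    have h := swRatioOK_swSizes n η v₀ E n d 0 fun j hj => swSize_ratio hgap h2v j ?_
    · rwa [swSize_zero] at h
    · have hj' : (j : ℝ) + 1 ≤ d := by exact_mod_cast (by omega : j + 1 ≤ d)
      nlinarith
  have hlastEq : swLast n (swSizes n η 0 d) = swSize n η d := by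
    have h := swLast_swSizes n η d 0
    rwa [swSize_zero, Nat.zero_add] at h
  -- the master inequality and the uniform error bound
  have hplanted := swForm_planted_le (k := ⌈(n : ℝ) ^ (1 / 2 - δ)⌉₊) hv₀pos (swSizes n η 0 d)
    (length_swSizes n η d 0) (f n) hfn hsz
  have hMb1 : 1 ≤ n ^ c * 2 ^ (r * d) := Nat.mul_pos (Nat.pow_pos hn1) (Nat.two_pow_pos _)
  have herr := swErr_le_uniform v₀ ⌈(n : ℝ) ^ (1 / 2 - δ)⌉₊ E d (n ^ c * 2 ^ (r * d)) (r + 1) hnpos hMb1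
    (by rw [← hr]; exact Nat.le_succ r) (swSizes n η 0 d) n (n ^ c) 1 (length_swSizes n η d 0).le
    (by rw [length_swSizes, ← hr]) (Nat.succ_le_succ (Nat.zero_le r)) hsz hrat
  rw [length_swSizes, hlastEq] at herr
  -- the two budgets, each `≤ 1/n`
  have hT : swT v₀ (n ^ c * 2 ^ (r * d)) (r + 1) = K₁ + n ^ c * 2 ^ (r * d) * K₂ := by
    simp only [swT, ← hr, hK₁, hK₂]
  have hstep : ((((n ^ c * 2 ^ (r * d)) ^ d * swT v₀ (n ^ c * 2 ^ (r * d)) (r + 1) : ℕ)) : ℝ≥0∞) /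
      ((n ^ E : ℕ) : ℝ≥0∞) ≤ ((n : ℝ≥0∞))⁻¹ := by
    refine natCast_div_le_inv ?_ (pow_pos hnpos _).ne' hnpos.ne'
    rw [hT, hE]
    exact swT_budget c d r K₁ K₂ n hK hn1
  have hfinal : (((r + 1) * ⌈(n : ℝ) ^ (1 / 2 - δ)⌉₊ ^ 2 : ℕ) : ℝ≥0∞) / ((swSize n η d ^ 2 : ℕ) : ℝ≥0∞) ≤
      ((n : ℝ≥0∞))⁻¹ := by
    refine natCast_div_le_inv hlast (pow_pos ?_ _).ne' hnpos.ne'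
    exact lt_of_lt_of_le (by omega) (hk2.trans hkd)
  calc (plantedCliqueDist n ⌈(n : ℝ) ^ (1 / 2 - δ)⌉₊).toOuterMeasure {x | swEval (d + 1) false (f n) x}
      ≤ _ := hplanted
    _ ≤ (erdosRenyiHalf n).toOuterMeasure {x | swEval (d + 1) false (f n) x} +
          ((d : ℝ≥0∞) * ((n : ℝ≥0∞))⁻¹ + ((n : ℝ≥0∞))⁻¹) := by
        refine add_le_add le_rfl (herr.trans (add_le_add ?_ hfinal))
        exact mul_le_mul' le_rfl hstep
    _ = _ := by push_cast; ring

/-- **Quiet polynomial-size monotone formulas of constant depth are blind to planted cliques below `√n`**: null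
acceptance `→ 0` implies planted acceptance (clique size `⌈n^{1/2-δ}⌉`) `→ 0`. [folklore] -/
theorem karlinRubin_constDepth_planted_tendsto_zero {δ : ℝ} (hδ : 0 < δ) (hδ' : δ < 1 / 2) (c d : ℕ)
    (f : (n : ℕ) → swForm n (d + 1)) (hf : ∀ᶠ n : ℕ in atTop, swBnd (n ^ c) 1 (d + 1) (f n))
    (hquiet : Tendsto (fun n : ℕ =>
      (erdosRenyiHalf n).toOuterMeasure {x | swEval (d + 1) false (f n) x}) atTop (𝓝 0)) :
    Tendsto (fun n : ℕ => (plantedCliqueDist n ⌈(n : ℝ) ^ (1 / 2 - δ)⌉₊).toOuterMeasure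
      {x | swEval (d + 1) false (f n) x}) atTop (𝓝 0) := by
  have hbound : Tendsto (fun n : ℕ => (erdosRenyiHalf n).toOuterMeasure {x | swEval (d + 1) false (f n) x} +
      ((d + 1 : ℕ) : ℝ≥0∞) * ((n : ℝ≥0∞))⁻¹) atTop (𝓝 0) := by
    have h2 := ENNReal.Tendsto.const_mul ENNReal.tendsto_inv_nat_nhds_zero
      (Or.inr (ENNReal.natCast_ne_top _) : (0 : ℝ≥0∞) ≠ 0 ∨ ((d + 1 : ℕ) : ℝ≥0∞) ≠ ⊤)
    simpa using hquiet.add h2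
  exact tendsto_of_tendsto_of_tendsto_of_le_of_le' tendsto_const_nhds hbound
    (Eventually.of_forall fun _ => bot_le) (karlinRubin_constDepth_planted_le_null_add hδ hδ' c d f hf)

/-- **`MonotoneBlind` for monotone AC⁰ (every constant depth, top gate AND).** For `0 < δ < 1/2` and all `c, d`: no
family of level-`(d+1)` layered monotone formulas with fan-ins `≤ n^c` above single slots has
`Pr_{G(n,1/2)}[f_n] + Pr_{G(n,1/2,⌈n^{1/2-δ}⌉)}[¬ f_n] → 0`. [folklore] -/
theorem karlinRubin_monotoneBlind_constDepth {δ : ℝ} (hδ : 0 < δ) (hδ' : δ < 1 / 2) (c d : ℕ)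
    (f : (n : ℕ) → swForm n (d + 1)) (hf : ∀ᶠ n : ℕ in atTop, swBnd (n ^ c) 1 (d + 1) (f n)) :
    ¬ Tendsto (fun n : ℕ =>
        (erdosRenyiHalf n).toOuterMeasure {x | swEval (d + 1) false (f n) x} +
          (plantedCliqueDist n ⌈(n : ℝ) ^ (1 / 2 - δ)⌉₊).toOuterMeasure {x | ¬ swEval (d + 1) false (f n) x})
      atTop (𝓝 0) := by
  intro hT
  have hquiet : Tendsto (fun n : ℕ =>
      (erdosRenyiHalf n).toOuterMeasure {x | swEval (d + 1) false (f n) x}) atTop (𝓝 0) :=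
    tendsto_of_tendsto_of_tendsto_of_le_of_le' tendsto_const_nhds hT (Eventually.of_forall fun _ => bot_le)
      (Eventually.of_forall fun _ => le_self_add)
  have hP := karlinRubin_constDepth_planted_tendsto_zero hδ hδ' c d f hf hquiet
  have hhalf : (0 : ℝ≥0∞) < 1 / 2 := by simp
  obtain ⟨n, hn1, hn2⟩ := ((hT.eventually (gt_mem_nhds hhalf)).and (hP.eventually (gt_mem_nhds hhalf))).exists
  have hcompl : (plantedCliqueDist n ⌈(n : ℝ) ^ (1 / 2 - δ)⌉₊).toOuterMeasure {x | swEval (d + 1) false (f n) x} +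
      (plantedCliqueDist n ⌈(n : ℝ) ^ (1 / 2 - δ)⌉₊).toOuterMeasure {x | ¬ swEval (d + 1) false (f n) x} = 1 := by
    have h := (plantedCliqueDist n ⌈(n : ℝ) ^ (1 / 2 - δ)⌉₊).toOuterMeasure_add_compl
      {x | swEval (d + 1) false (f n) x}
    have hc : {x : EdgeVec n | ¬ swEval (d + 1) false (f n) x} = {x : EdgeVec n | swEval (d + 1) false (f n) x}ᶜ := by
      ext x; simp
    rw [hc]
    exact h
  have hR : (plantedCliqueDist n ⌈(n : ℝ) ^ (1 / 2 - δ)⌉₊).toOuterMeasure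
      {x | ¬ swEval (d + 1) false (f n) x} < 1 / 2 := lt_of_le_of_lt le_add_self hn1
  have hlt : (1 : ℝ≥0∞) < 1 / 2 + 1 / 2 := by
    calc (1 : ℝ≥0∞) = _ := hcompl.symm
      _ < 1 / 2 + 1 / 2 := ENNReal.add_lt_add hn2 hR
  rw [ENNReal.add_halves] at hlt
  exact lt_irrefl _ hlt

/-- **`MonotoneBlind` for monotone AC⁰, either top gate.** The same for top gate OR (`pol = true`) or AND
(`pol = false`): wrap an OR-top formula into a one-child AND. [folklore] -/
theorem karlinRubin_monotoneBlind_constDepth' {δ : ℝ} (hδ : 0 < δ) (hδ' : δ < 1 / 2) (c d : ℕ) (pol : Bool)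
    (f : (n : ℕ) → swForm n (d + 1)) (hf : ∀ᶠ n : ℕ in atTop, swBnd (n ^ c) 1 (d + 1) (f n)) :
    ¬ Tendsto (fun n : ℕ =>
        (erdosRenyiHalf n).toOuterMeasure {x | swEval (d + 1) pol (f n) x} +
          (plantedCliqueDist n ⌈(n : ℝ) ^ (1 / 2 - δ)⌉₊).toOuterMeasure {x | ¬ swEval (d + 1) pol (f n) x})
      atTop (𝓝 0) := by
  cases pol
  · exact karlinRubin_monotoneBlind_constDepth hδ hδ' c d f hf
  · -- wrap: `g n = AND [f n]` at level `d + 2`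
    have hg : ∀ᶠ n : ℕ in atTop, swBnd (n ^ c) 1 (d + 2) (swForm.node [f n]) := by
      filter_upwards [hf, eventually_ge_atTop 1] with n hfn hn1
      rw [swBnd_succ]
      refine ⟨?_, fun g hg => ?_⟩
      · simpa using Nat.one_le_pow c n hn1
      · rw [swForm.kids, List.mem_singleton] at hg
        subst hg
        exact hfn
    have h := karlinRubin_monotoneBlind_constDepth hδ hδ' c (d + 1) (fun n => swForm.node [f n]) hg
    have hev : ∀ n (x : EdgeVec n), swEval (d + 2) false (swForm.node [f n]) x ↔ swEval (d + 1) true (f n) x := by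
      intro n x
      rw [swEval_succ_false]
      simp [swForm.kids]
    simpa only [hev] using h

/-- Registered stub `stub_constDepthBlind` of the AC⁰ line, stage C (side result of stmt-PneNP-18027, seat 0). [folklore] -/
theorem stub_constDepthBlind : ∀ δ : ℝ, 0 < δ → δ < 1 / 2 → ∀ (c d : ℕ) (pol : Bool) (f : (n : ℕ) → swForm n (d + 1)), (∀ᶠ n : ℕ in Filter.atTop, swBnd (n ^ c) 1 (d + 1) (f n)) → ¬ Filter.Tendsto (fun n : ℕ => (erdosRenyiHalf n).toOuterMeasure {x | swEval (d + 1) pol (f n) x} + (plantedCliqueDist n ⌈(n : ℝ) ^ (1 / 2 - δ)⌉₊).toOuterMeasure {x | ¬ swEval (d + 1) pol (f n) x}) Filter.atTop (nhds 0) := 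
  fun _ hδ hδ' c d pol f hf => karlinRubin_monotoneBlind_constDepth' hδ hδ' c d pol f hf

end Summit.PneNP.PneNP.Theorems
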